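import Literature.MathematicalPhysics.QuantumFieldTheory.Balaban1983to89.Beta.HessianTelescopingKKT
import Summits.QuantumFields.BalabanUV.Beta.FP.KernelLawDeperiodised
import Summits.QuantumFields.BalabanUV.Beta.CombOneShotJets

/-!
# `BalabanUV.Beta.FP.StepRecursionFeed` — road «FP» for binder row D1, ROUTE T, RULING R-FP-57 (memo `N2B-DESIGN.md` §30 (30h), TID § F.10): **THE (F1) END
# SOCKET — from the (STEP) door's three LATTICE KERNELS per `j ≥ 1` (law + identifications, or their torus sequences) to an4's `StepRecursion` and to `D1Tel`**

WHY (R-FP-57).  Route T targets (F1) = an4's KERNEL-LEVEL `HessianTelescopingKKT.StepRecursion Lc (TbalOf Lc Js) (TshotOf Lc Jc) w` at the (III′) literal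
(`∀ j ≥ 1, TshotOf (j+1) a b z = Lc⁸·dressedEntry (w j) (TshotOf j) (Lc•z) a b + TbalOf j a b z`, EXACT at every `j`, base level `0`), whence the ROOT of record's
`htel : D1Tel Lc Js Jc` by `d1Tel_of_stepRecursion_of_stepWard ∕ _wStep`.  What the road delivers per `j ≥ 1` (TID § F.10 (L1)+(L2′)) is: three lattice kernels
`𝒦N j, 𝒦F j, 𝒦G j : EKer 4` — the depth-`(j−1)` door at base level `0` packed over `r := col_{j+1}·h̄` (#20 `SecondVarKernelLaw`, #24 `KernelDoorLegCurrency`,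
#26 `PackedRepacking`) and de-periodised (#23 `KernelLawDeperiodised`, leaf-06's (P2″)∕(P2‴)) —, the LAW `𝒦N j = 𝒦F j + 𝒦G j` entrywise on `ℤ⁴` (L1), and the
IDENTIFICATIONS (L2′): `𝒦N j = TshotOf (j+1)` (the one-shot system IS `TOf (JcOf (j+1))`), `𝒦F j a b z = Lc⁸·dressedEntry (w j) (TshotOf j) (Lc•z) a b` ((C1) column
factorisation `col_{j+1} = col_j ∘ w_j`; lattice side = leaf-02 g15's `TransportFineFactor.hessKer_nest_eq_dressedEntry` pattern), `𝒦G j = TbalOf j` ((C2) `hId₁ hId₂`).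
THIS FILE is the [folklore] bookkeeping from there to `StepRecursion` ∕ `StepRecursionUpTo` ∕ `D1Tel` — the (F1) twin of #25 `StepLawFeed` (which is the (F2)
FALLBACK under R-FP-56 (b)):
* §1 KERNEL-ENTRY LEVEL (abstract families `T 𝒯 w`): **`stepRecursion_of_kernel_laws`** (law + three identifications ⟹ `StepRecursion Lc T 𝒯 w`);
  **`stepRecursionUpTo_of_kernel_laws`** (law WITH an explicit door defect `D j` — R-FP-56 (b)'s priced branch `−2·𝒦_uTop`, or an3's LEMMA-N remainder —
  ⟹ `StepRecursionUpTo Lc T 𝒯 w D`); `stepRecursionUpTo_of_identifications` (no law at all: the remainder IS `𝒦N − 𝒦F − 𝒦G`, for free).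
* §2 TORUS-SEQUENCE LEVEL: **`stepRecursion_of_torus_kernel_laws`** — per `(j, a, b, z)` three real sequences (the door's torus kernels on the boxes `k ↦ M_k`)
  obeying the law at every `k` and converging to the identified lattice values ⟹ `StepRecursion` (#23 `law_of_tendsto` BY NAME — the convergences are
  leaf-06's (P2‴) `tendsto_hessT_perF_hessKer` ∕ (P2″) words, DISPLAYED here); `stepRecursionUpTo_of_torus_kernel_laws` (with a converging defect sequence).
* §3 OVER JET DATA, CANONICAL WEIGHT: **`d1Tel_of_kernel_laws_wStep`**, **`d1Tel_of_torus_kernel_laws_wStep`** (§1∕§2 ∘ an4's `d1Tel_of_stepRecursion_wStep`: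
  the road's three rows + (T0)(T1) of the step kernels + `hbase` ⟹ `D1Tel Lc Js Jc`), `d1Tel_of_kernel_laws_of_stepWard` (general weight with its reproduction
  letters `hwC hwL hwA`), **`d1Tel_of_kernel_laws_upTo_wStep`** (the priced branch: the defect's decimated moments of order 0, 1 vanish, `AbsMoment₂`, and its
  second-moment TENSOR vanishes — an4's §8 binders `hR0 hR1 hRA hR2` VERBATIM).
* §4 `hessKer` CURRENCY: **`stepRecursion_of_hessKer_laws`** — the law as leaf-06's (P2‴) §4 hands it over (`hessKer AN 𝒱N 𝒲N = hessKer AF 𝒱F 𝒲F + hessKer AG 𝒱G 𝒲G`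
  on `Fin 4 × Fin 4 × ℤ⁴`, three INDEPENDENT systems per `j`) with the three identifications in `hessKer` form.
* §5 AT THE (III′) LITERAL OF RECORD: **`d1Tel_JcOf_of_kernel_laws_wStep`** ∕ `…_upTo_wStep` — `Js := JsB12CombShSym hLc N (symTablesAn1S2 3 Lc cΛ) cΛ cB` (M‴'s
  `htel` literal, `CombRemainderParityAll` :272) and `Jc := JcOf hLc N (fun _ => cΛ) (fun _ => cB)` ((L3′), an2's (J1) naming p339189 ✓): (L3′) `hbase` is
  DISCHARGED by an2's `CombOneShotJets.TshotOf_JcOf_one`; the conclusion `D1Tel Lc Js (JcOf …)` is M‴'s `htel` binder VERBATIM at that `Jc`.  Displayed: (L1),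
  (L2′), (L4′) `hT0 hT1` — nothing else.  And **`d1Tel_anchored_of_kernel_laws_wStep`**: the same for ANY composite family `Jc` with `Jc 1 = JcOf … 1`
  (R-D1-g42-4 (3): the `Jc` of record is the composite-contour literal `JcComp`, anchored at `m = 1` on `JcOf`) — the END typed for `JcComp` before it is named.
WHAT STAYS DISPLAYED (the road's rows, holders in TID § F.10): (L1) the law per `j` (OWNER assembly `FP/NestedStepLawLatticeKernel(LevelZero)` over leaf-02's closed
door U20 ∕ #21-ROWS, leaf-05's legs, an2's tables; de-periodisation leaf-06 + #23); (L2′) the three identifications ((C1)(C2): an2 ∕ leaf-05; the `N`-side is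
`TOf`'s unfolding at `JcOf`); (L3′) `hbase : TshotOf Lc Jc 1 = TbalOf Lc Js 0` (an2 `CombOneShotJets.TshotOf_JcOf_one` — DISCHARGED in §5 at the literal);
(L4′) `hT0 hT1` (an4 ∕ `KernelWard`).
No `def`, no `def … : Prop`, nothing cited, 0 sorry; the only analysis is `tendsto_nhds_unique` inside #23's socket.

HONEST DEPENDENCY (page 1, mandatory): continuum YM on T⁴ ⇐ BetaPertH ∧ nine spine estimates (0/9 proved); BetaPertH ⇐ (D1) ∧ (D4) ∧ CAP+tail;
G-an2-4 gates asym, D1 and NE2/3/4.  HONEST FRAMING (cell contract, verbatim): «discharging `BetaPertH` makes Bałaban's UV stability UNCONDITIONAL —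
a real constructive-QFT result; it is NOT the continuum limit and NOT the Clay problem.»  ABSOLUTE RULE (cell charter, verbatim): «No internally-minted
statement may enter as a cited fact. Every hypothesis is either kernel-proved in this package or a verbatim quotation of a PUBLISHED theorem with page
reference. The manuscript(s) under audit are NOT citable for their own disputed steps — they are the thing under adjudication; programme-internal
(2001/route/tribunal) claims are never citable.»  [folklore] bookkeeping; nothing of Bałaban's asserted; 0 estimates; 0∕4 row-D1 binders (every row above
stays a hypothesis; `D1Tel` is concluded ONLY from them); NOT (T-ID), NOT SDF, NOT D1, NOT BetaPertH, NOT continuum, NOT Clay.  Road «FP» OWNER,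
b2b-balaban-beta-d1-p3 gen 22, 2026-08-22.  No existing file touched.
-/

noncomputable section

namespace Summit.QuantumFields.BalabanUV.Beta.FP.StepRecursionFeed

open Filter Topology
open Literature.MathematicalPhysics.QuantumFieldTheory.Balaban1983to89
open Literature.MathematicalPhysics.QuantumFieldTheory.Balaban1983to89.Beta
open DecimatedMomentSummable (AbsMoment₂ ConstReproSum LinReproSum)
open DressedMomentNormalisation (EKer dressedEntry m2Tensor)
open ExpKernelCalculus (MKer hessKer)
open OneStepResolventKernel (Fib JetData)
open OneStepKernelFamily (TbalOf TshotOf D1Tel)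
open HessianTelescopingKKT (StepRecursion StepRecursionUpTo wStep d1Tel_of_stepRecursion_wStep d1Tel_of_stepRecursion_of_stepWard
  d1Tel_of_stepRecursionUpTo_wStep)
open Summit.QuantumFields.BalabanUV.Beta.FP.KernelLawDeperiodised (law_of_tendsto)
open Summit.QuantumFields.BalabanUV.Beta.SymSecondOrderTablesAn1 (symTablesAn1S2)
open Summit.QuantumFields.BalabanUV.Beta.CombChartJointEnd (JsB12CombShSym)
open Summit.QuantumFields.BalabanUV.Beta.CombOneShotJets (JcOf TshotOf_JcOf_one)

/-! ## §1 Kernel-entry level: law + identifications ⟹ `StepRecursion` -/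

section Entry

variable {Lc : ℕ} {T 𝒯 : ℕ → EKer 4} {w : ℕ → EKer 4}

/-- [folklore] **THE (F1) SOCKET AT KERNEL-ENTRY LEVEL.**  Per `j ≥ 1` three lattice kernels with the de-periodised door `𝒦N j = 𝒦F j + 𝒦G j` (L1) and the
identifications (L2′) — one-shot `𝒦N j = 𝒯 (j+1)`, fine-dressed `𝒦F j a b z = Lc⁸·dressedEntry (w j) (𝒯 j) (Lc•z) a b` ((C1)), top step `𝒦G j = T j` ((C2)) — give
an4's `StepRecursion Lc T 𝒯 w`. -/
theorem stepRecursion_of_kernel_laws (𝒦N 𝒦F 𝒦G : ℕ → EKer 4)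
    (hlaw : ∀ j : ℕ, 1 ≤ j → ∀ (a b : Fin 4) (z : Fin 4 → ℤ), 𝒦N j a b z = 𝒦F j a b z + 𝒦G j a b z)
    (hN : ∀ j : ℕ, 1 ≤ j → ∀ (a b : Fin 4) (z : Fin 4 → ℤ), 𝒦N j a b z = 𝒯 (j + 1) a b z)
    (hF : ∀ j : ℕ, 1 ≤ j → ∀ (a b : Fin 4) (z : Fin 4 → ℤ), 𝒦F j a b z = (Lc : ℝ) ^ 8 * dressedEntry (w j) (𝒯 j) ((Lc : ℤ) • z) a b)
    (hG : ∀ j : ℕ, 1 ≤ j → ∀ (a b : Fin 4) (z : Fin 4 → ℤ), 𝒦G j a b z = T j a b z) :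
    StepRecursion Lc T 𝒯 w := by
  intro j hj a b z
  rw [← hN j hj a b z, hlaw j hj a b z, hF j hj a b z, hG j hj a b z]

/-- [folklore] **THE PRICED BRANCH (R-FP-56 (b)) AT KERNEL-ENTRY LEVEL.**  The de-periodised door WITH an explicit defect family `D j` (`𝒦N = 𝒦F + 𝒦G + D`, e.g.
`D j = −2·𝒦_uTop j` from `CoarseFPDefect`, or a longitudinal remainder) and the same identifications give `StepRecursionUpTo Lc T 𝒯 w D`. -/
theorem stepRecursionUpTo_of_kernel_laws (𝒦N 𝒦F 𝒦G D : ℕ → EKer 4)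
    (hlaw : ∀ j : ℕ, 1 ≤ j → ∀ (a b : Fin 4) (z : Fin 4 → ℤ), 𝒦N j a b z = 𝒦F j a b z + 𝒦G j a b z + D j a b z)
    (hN : ∀ j : ℕ, 1 ≤ j → ∀ (a b : Fin 4) (z : Fin 4 → ℤ), 𝒦N j a b z = 𝒯 (j + 1) a b z)
    (hF : ∀ j : ℕ, 1 ≤ j → ∀ (a b : Fin 4) (z : Fin 4 → ℤ), 𝒦F j a b z = (Lc : ℝ) ^ 8 * dressedEntry (w j) (𝒯 j) ((Lc : ℤ) • z) a b)
    (hG : ∀ j : ℕ, 1 ≤ j → ∀ (a b : Fin 4) (z : Fin 4 → ℤ), 𝒦G j a b z = T j a b z) :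
    StepRecursionUpTo Lc T 𝒯 w D := by
  intro j hj a b z
  rw [← hN j hj a b z, hlaw j hj a b z, hF j hj a b z, hG j hj a b z]

/-- [folklore] **NO LAW: THE REMAINDER IS THE DOOR's DEFECT, FOR FREE.**  With the three identifications alone, `StepRecursionUpTo` holds with the remainder
`𝒦N j − 𝒦F j − 𝒦G j` — all content of (L1) is then in whatever is later proved about that remainder (an4's `stepRecursionUpTo_stepDefect` pattern). -/
theorem stepRecursionUpTo_of_identifications (𝒦N 𝒦F 𝒦G : ℕ → EKer 4)
    (hN : ∀ j : ℕ, 1 ≤ j → ∀ (a b : Fin 4) (z : Fin 4 → ℤ), 𝒦N j a b z = 𝒯 (j + 1) a b z)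
    (hF : ∀ j : ℕ, 1 ≤ j → ∀ (a b : Fin 4) (z : Fin 4 → ℤ), 𝒦F j a b z = (Lc : ℝ) ^ 8 * dressedEntry (w j) (𝒯 j) ((Lc : ℤ) • z) a b)
    (hG : ∀ j : ℕ, 1 ≤ j → ∀ (a b : Fin 4) (z : Fin 4 → ℤ), 𝒦G j a b z = T j a b z) :
    StepRecursionUpTo Lc T 𝒯 w (fun j a b z => 𝒦N j a b z - 𝒦F j a b z - 𝒦G j a b z) := by
  intro j hj a b z
  dsimp only
  rw [hN j hj a b z, hF j hj a b z, hG j hj a b z]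
  ring

/-- [folklore] The law splits a kernel-entry defect off `StepRecursion`: if the remainder of `stepRecursionUpTo_of_identifications` vanishes (the door exact,
(L1)), `StepRecursion` holds — the converse bookkeeping of `stepRecursion_of_kernel_laws`, through an4's `stepRecursionUpTo_zero_iff`. -/
theorem stepRecursion_of_identifications_of_sub_eq_zero (𝒦N 𝒦F 𝒦G : ℕ → EKer 4)
    (hN : ∀ j : ℕ, 1 ≤ j → ∀ (a b : Fin 4) (z : Fin 4 → ℤ), 𝒦N j a b z = 𝒯 (j + 1) a b z)
    (hF : ∀ j : ℕ, 1 ≤ j → ∀ (a b : Fin 4) (z : Fin 4 → ℤ), 𝒦F j a b z = (Lc : ℝ) ^ 8 * dressedEntry (w j) (𝒯 j) ((Lc : ℤ) • z) a b)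
    (hG : ∀ j : ℕ, 1 ≤ j → ∀ (a b : Fin 4) (z : Fin 4 → ℤ), 𝒦G j a b z = T j a b z)
    (hzero : ∀ j : ℕ, 1 ≤ j → ∀ (a b : Fin 4) (z : Fin 4 → ℤ), 𝒦N j a b z - 𝒦F j a b z - 𝒦G j a b z = 0) :
    StepRecursion Lc T 𝒯 w :=
  stepRecursion_of_kernel_laws 𝒦N 𝒦F 𝒦G (fun j hj a b z => by linarith [hzero j hj a b z]) hN hF hG

end Entry

/-! ## §2 Torus-sequence level: the law on every box + the three convergences ⟹ `StepRecursion` -/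

section Torus

variable {Lc : ℕ} {T 𝒯 : ℕ → EKer 4} {w : ℕ → EKer 4}

/-- [folklore] **THE (F1) SOCKET AT TORUS-SEQUENCE LEVEL.**  For every `j ≥ 1` and every coarse bond entry `(a, b, z)` three real sequences `k ↦ KX j k a b z`
(the door's torus kernels on the growing boxes `M_k`, in leg currency — #24) with the law AT EVERY `k` and the three convergences to the identified lattice
values (leaf-06's (P2‴) `tendsto_hessT_perF_hessKer` ∕ (P2″) words + (L2′)) give `StepRecursion Lc T 𝒯 w` — #23 `law_of_tendsto` entry by entry. -/
theorem stepRecursion_of_torus_kernel_laws (KN KF KG : ℕ → ℕ → EKer 4)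
    (hlaw : ∀ j : ℕ, 1 ≤ j → ∀ (k : ℕ) (a b : Fin 4) (z : Fin 4 → ℤ), KN j k a b z = KF j k a b z + KG j k a b z)
    (hN : ∀ j : ℕ, 1 ≤ j → ∀ (a b : Fin 4) (z : Fin 4 → ℤ), Tendsto (fun k => KN j k a b z) atTop (𝓝 (𝒯 (j + 1) a b z)))
    (hF : ∀ j : ℕ, 1 ≤ j → ∀ (a b : Fin 4) (z : Fin 4 → ℤ),
      Tendsto (fun k => KF j k a b z) atTop (𝓝 ((Lc : ℝ) ^ 8 * dressedEntry (w j) (𝒯 j) ((Lc : ℤ) • z) a b)))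
    (hG : ∀ j : ℕ, 1 ≤ j → ∀ (a b : Fin 4) (z : Fin 4 → ℤ), Tendsto (fun k => KG j k a b z) atTop (𝓝 (T j a b z))) :
    StepRecursion Lc T 𝒯 w :=
  fun j hj a b z => law_of_tendsto (hN j hj a b z) (hF j hj a b z) (hG j hj a b z) (fun k => hlaw j hj k a b z)

/-- [folklore] **THE PRICED BRANCH AT TORUS-SEQUENCE LEVEL**: the law on every box WITH a torus defect sequence converging to `D j a b z` gives
`StepRecursionUpTo Lc T 𝒯 w D`. -/
theorem stepRecursionUpTo_of_torus_kernel_laws (KN KF KG KD : ℕ → ℕ → EKer 4) (D : ℕ → EKer 4)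
    (hlaw : ∀ j : ℕ, 1 ≤ j → ∀ (k : ℕ) (a b : Fin 4) (z : Fin 4 → ℤ), KN j k a b z = KF j k a b z + KG j k a b z + KD j k a b z)
    (hN : ∀ j : ℕ, 1 ≤ j → ∀ (a b : Fin 4) (z : Fin 4 → ℤ), Tendsto (fun k => KN j k a b z) atTop (𝓝 (𝒯 (j + 1) a b z)))
    (hF : ∀ j : ℕ, 1 ≤ j → ∀ (a b : Fin 4) (z : Fin 4 → ℤ),
      Tendsto (fun k => KF j k a b z) atTop (𝓝 ((Lc : ℝ) ^ 8 * dressedEntry (w j) (𝒯 j) ((Lc : ℤ) • z) a b)))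
    (hG : ∀ j : ℕ, 1 ≤ j → ∀ (a b : Fin 4) (z : Fin 4 → ℤ), Tendsto (fun k => KG j k a b z) atTop (𝓝 (T j a b z)))
    (hD : ∀ j : ℕ, 1 ≤ j → ∀ (a b : Fin 4) (z : Fin 4 → ℤ), Tendsto (fun k => KD j k a b z) atTop (𝓝 (D j a b z))) :
    StepRecursionUpTo Lc T 𝒯 w D :=
  fun j hj a b z => law_of_tendsto (hN j hj a b z) ((hF j hj a b z).add (hG j hj a b z)) (hD j hj a b z)
    (fun k => hlaw j hj k a b z)

end Torus

/-! ## §3 Over jet data: the road's rows ⟹ `D1Tel` (an4's node theorems BY NAME) -/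

section JetData

variable {Lc : ℕ} [NeZero Lc]

/-- [folklore] **`D1Tel` FROM THE ROAD's KERNEL ROWS, CANONICAL WEIGHT** (R-FP-57's END): (L1) the de-periodised door per `j ≥ 1`, (L2′) the three identifications
at `T := TbalOf Lc Js`, `𝒯 := TshotOf Lc Jc`, `w := wStep Lc`, (L3′) `hbase`, (L4′) (T0)(T1) of the step kernels ⟹ `D1Tel Lc Js Jc` —
`stepRecursion_of_kernel_laws` ∘ an4's `d1Tel_of_stepRecursion_wStep`. -/
theorem d1Tel_of_kernel_laws_wStep (Js : ℕ → JetData 3 Lc) (Jc : ∀ m : ℕ, JetData 3 (Lc ^ m)) (𝒦N 𝒦F 𝒦G : ℕ → EKer 4)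
    (hlaw : ∀ j : ℕ, 1 ≤ j → ∀ (a b : Fin 4) (z : Fin 4 → ℤ), 𝒦N j a b z = 𝒦F j a b z + 𝒦G j a b z)
    (hN : ∀ j : ℕ, 1 ≤ j → ∀ (a b : Fin 4) (z : Fin 4 → ℤ), 𝒦N j a b z = TshotOf Lc Jc (j + 1) a b z)
    (hF : ∀ j : ℕ, 1 ≤ j → ∀ (a b : Fin 4) (z : Fin 4 → ℤ),
      𝒦F j a b z = (Lc : ℝ) ^ 8 * dressedEntry (wStep Lc j) (TshotOf Lc Jc j) ((Lc : ℤ) • z) a b)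
    (hG : ∀ j : ℕ, 1 ≤ j → ∀ (a b : Fin 4) (z : Fin 4 → ℤ), 𝒦G j a b z = TbalOf Lc Js j a b z)
    (hT0 : ∀ j (c e : Fin 4), HasSum (TbalOf Lc Js j c e) 0)
    (hT1 : ∀ j (c e ρ : Fin 4), HasSum (fun t : Fin 4 → ℤ => t ρ • TbalOf Lc Js j c e t) 0)
    (hbase : TshotOf Lc Jc 1 = TbalOf Lc Js 0) : D1Tel Lc Js Jc :=
  d1Tel_of_stepRecursion_wStep Js Jc hT0 hT1 hbase (stepRecursion_of_kernel_laws 𝒦N 𝒦F 𝒦G hlaw hN hF hG)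

/-- [folklore] **`D1Tel` FROM THE ROAD's KERNEL ROWS, GENERAL WEIGHT**: the same with a displayed transport weight `w` and its reproduction letters
(`hwC hwL hwA` — Kronecker coset mass `δ·Lc^{−5}`, affine reproduction, `AbsMoment₂`) — an4's `d1Tel_of_stepRecursion_of_stepWard`. -/
theorem d1Tel_of_kernel_laws_of_stepWard (Js : ℕ → JetData 3 Lc) (Jc : ∀ m : ℕ, JetData 3 (Lc ^ m)) {w : ℕ → EKer 4} (𝒦N 𝒦F 𝒦G : ℕ → EKer 4)
    (hlaw : ∀ j : ℕ, 1 ≤ j → ∀ (a b : Fin 4) (z : Fin 4 → ℤ), 𝒦N j a b z = 𝒦F j a b z + 𝒦G j a b z)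
    (hN : ∀ j : ℕ, 1 ≤ j → ∀ (a b : Fin 4) (z : Fin 4 → ℤ), 𝒦N j a b z = TshotOf Lc Jc (j + 1) a b z)
    (hF : ∀ j : ℕ, 1 ≤ j → ∀ (a b : Fin 4) (z : Fin 4 → ℤ),
      𝒦F j a b z = (Lc : ℝ) ^ 8 * dressedEntry (w j) (TshotOf Lc Jc j) ((Lc : ℤ) • z) a b)
    (hG : ∀ j : ℕ, 1 ≤ j → ∀ (a b : Fin 4) (z : Fin 4 → ℤ), 𝒦G j a b z = TbalOf Lc Js j a b z)
    (hT0 : ∀ j (c e : Fin 4), HasSum (TbalOf Lc Js j c e) 0)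
    (hT1 : ∀ j (c e ρ : Fin 4), HasSum (fun t : Fin 4 → ℤ => t ρ • TbalOf Lc Js j c e t) 0)
    (hwC : ∀ j, 1 ≤ j → ∀ κ l : Fin 4, ConstReproSum Lc (w j κ l) (if κ = l then (((Lc : ℝ) ^ (4 + 1))⁻¹) else 0))
    (hwL : ∀ j, 1 ≤ j → ∀ κ l : Fin 4, ∃ C : Fin 4 → ℝ, LinReproSum Lc (w j κ l) C)
    (hwA : ∀ j, 1 ≤ j → ∀ κ l : Fin 4, AbsMoment₂ (w j κ l))
    (hbase : TshotOf Lc Jc 1 = TbalOf Lc Js 0) : D1Tel Lc Js Jc :=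
  d1Tel_of_stepRecursion_of_stepWard Js Jc hT0 hT1 hwC hwL hwA hbase (stepRecursion_of_kernel_laws 𝒦N 𝒦F 𝒦G hlaw hN hF hG)

/-- [folklore] **`D1Tel` FROM THE ROAD's TORUS ROWS, CANONICAL WEIGHT**: the door on every box + the three convergences per entry + `hbase` + (T0)(T1)
⟹ `D1Tel Lc Js Jc` — `stepRecursion_of_torus_kernel_laws` ∘ `d1Tel_of_stepRecursion_wStep`. -/
theorem d1Tel_of_torus_kernel_laws_wStep (Js : ℕ → JetData 3 Lc) (Jc : ∀ m : ℕ, JetData 3 (Lc ^ m)) (KN KF KG : ℕ → ℕ → EKer 4)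
    (hlaw : ∀ j : ℕ, 1 ≤ j → ∀ (k : ℕ) (a b : Fin 4) (z : Fin 4 → ℤ), KN j k a b z = KF j k a b z + KG j k a b z)
    (hN : ∀ j : ℕ, 1 ≤ j → ∀ (a b : Fin 4) (z : Fin 4 → ℤ), Tendsto (fun k => KN j k a b z) atTop (𝓝 (TshotOf Lc Jc (j + 1) a b z)))
    (hF : ∀ j : ℕ, 1 ≤ j → ∀ (a b : Fin 4) (z : Fin 4 → ℤ),
      Tendsto (fun k => KF j k a b z) atTop (𝓝 ((Lc : ℝ) ^ 8 * dressedEntry (wStep Lc j) (TshotOf Lc Jc j) ((Lc : ℤ) • z) a b)))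
    (hG : ∀ j : ℕ, 1 ≤ j → ∀ (a b : Fin 4) (z : Fin 4 → ℤ), Tendsto (fun k => KG j k a b z) atTop (𝓝 (TbalOf Lc Js j a b z)))
    (hT0 : ∀ j (c e : Fin 4), HasSum (TbalOf Lc Js j c e) 0)
    (hT1 : ∀ j (c e ρ : Fin 4), HasSum (fun t : Fin 4 → ℤ => t ρ • TbalOf Lc Js j c e t) 0)
    (hbase : TshotOf Lc Jc 1 = TbalOf Lc Js 0) : D1Tel Lc Js Jc :=
  d1Tel_of_stepRecursion_wStep Js Jc hT0 hT1 hbase (stepRecursion_of_torus_kernel_laws KN KF KG hlaw hN hF hG)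

/-- [folklore] **`D1Tel` ON THE PRICED BRANCH (R-FP-56 (b)), CANONICAL WEIGHT**: the door with a defect family `D j`, the identifications, `hbase`, (T0)(T1),
and an4's §8 remainder binders for `D` VERBATIM — vanishing zeroth and first decimated moments (`hD0 hD1`, so the one-shot Ward data are inherited), `AbsMoment₂`
(`hDA`) and VANISHING SECOND-MOMENT TENSOR (`hD2`) for `j ≥ 1` ⟹ `D1Tel Lc Js Jc` (`d1Tel_of_stepRecursionUpTo_wStep`).  This is where a non-square-law
coarse Faddeev–Popov jet (`CoarseFPDefect`) is paid for: its de-periodised kernel must be invisible at the second-moment level. -/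
theorem d1Tel_of_kernel_laws_upTo_wStep (Js : ℕ → JetData 3 Lc) (Jc : ∀ m : ℕ, JetData 3 (Lc ^ m)) (𝒦N 𝒦F 𝒦G D : ℕ → EKer 4)
    (hlaw : ∀ j : ℕ, 1 ≤ j → ∀ (a b : Fin 4) (z : Fin 4 → ℤ), 𝒦N j a b z = 𝒦F j a b z + 𝒦G j a b z + D j a b z)
    (hN : ∀ j : ℕ, 1 ≤ j → ∀ (a b : Fin 4) (z : Fin 4 → ℤ), 𝒦N j a b z = TshotOf Lc Jc (j + 1) a b z)
    (hF : ∀ j : ℕ, 1 ≤ j → ∀ (a b : Fin 4) (z : Fin 4 → ℤ),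
      𝒦F j a b z = (Lc : ℝ) ^ 8 * dressedEntry (wStep Lc j) (TshotOf Lc Jc j) ((Lc : ℤ) • z) a b)
    (hG : ∀ j : ℕ, 1 ≤ j → ∀ (a b : Fin 4) (z : Fin 4 → ℤ), 𝒦G j a b z = TbalOf Lc Js j a b z)
    (hT0 : ∀ j (c e : Fin 4), HasSum (TbalOf Lc Js j c e) 0)
    (hT1 : ∀ j (c e ρ : Fin 4), HasSum (fun t : Fin 4 → ℤ => t ρ • TbalOf Lc Js j c e t) 0)
    (hD0 : ∀ j, 1 ≤ j → ∀ c e : Fin 4, HasSum (D j c e) 0)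
    (hD1 : ∀ j, 1 ≤ j → ∀ c e ρ : Fin 4, HasSum (fun t : Fin 4 → ℤ => t ρ • D j c e t) 0)
    (hDA : ∀ j, 1 ≤ j → ∀ c e : Fin 4, AbsMoment₂ (D j c e)) (hD2 : ∀ j, 1 ≤ j → m2Tensor (D j) = 0)
    (hbase : TshotOf Lc Jc 1 = TbalOf Lc Js 0) : D1Tel Lc Js Jc :=
  d1Tel_of_stepRecursionUpTo_wStep Js Jc hT0 hT1 hD0 hD1 hDA hD2 hbase (stepRecursionUpTo_of_kernel_laws 𝒦N 𝒦F 𝒦G D hlaw hN hF hG)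

end JetData

/-! ## §4 `hessKer` currency: the law as (P2‴) §4 hands it over -/

section HessKer

variable {Lc : ℕ} {T 𝒯 : ℕ → EKer 4} {w : ℕ → EKer 4} {FN FF FG : Type*} [Fintype FN] [Fintype FF] [Fintype FG]

/-- [folklore] **THE (F1) SOCKET IN `hessKer` CURRENCY.**  Per `j ≥ 1` three INDEPENDENT lattice one-loop systems (leg `AX j`, vertex families `𝒱X j`, `𝒲X j`,
each on its own fibre) whose `ExpKernelCalculus.hessKer`s obey the de-periodised door (leaf-06's `KernelPeriodisationFibHessKer.hessKer_law_of_torus_hessT_law`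
output shape VERBATIM) and are identified with `𝒯 (j+1)`, `Lc⁸·dressedEntry (w j) (𝒯 j) (Lc•·)` (TRANSPORT′ shape: `TransportFineFactor.hessKer_nest_eq_dressedEntry`)
and `T j` ⟹ `StepRecursion Lc T 𝒯 w`. -/
theorem stepRecursion_of_hessKer_laws
    (AN : ℕ → MKer 4 FN) (𝒱N : ℕ → Fin 4 → (Fin 4 → ℤ) → MKer 4 FN) (𝒲N : ℕ → Fin 4 → (Fin 4 → ℤ) → Fin 4 → (Fin 4 → ℤ) → MKer 4 FN)
    (AF : ℕ → MKer 4 FF) (𝒱F : ℕ → Fin 4 → (Fin 4 → ℤ) → MKer 4 FF) (𝒲F : ℕ → Fin 4 → (Fin 4 → ℤ) → Fin 4 → (Fin 4 → ℤ) → MKer 4 FF)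
    (AG : ℕ → MKer 4 FG) (𝒱G : ℕ → Fin 4 → (Fin 4 → ℤ) → MKer 4 FG) (𝒲G : ℕ → Fin 4 → (Fin 4 → ℤ) → Fin 4 → (Fin 4 → ℤ) → MKer 4 FG)
    (hlaw : ∀ j : ℕ, 1 ≤ j → ∀ (μ ν : Fin 4) (z : Fin 4 → ℤ),
      hessKer (AN j) (𝒱N j) (𝒲N j) μ ν z = hessKer (AF j) (𝒱F j) (𝒲F j) μ ν z + hessKer (AG j) (𝒱G j) (𝒲G j) μ ν z)
    (hN : ∀ j : ℕ, 1 ≤ j → ∀ (μ ν : Fin 4) (z : Fin 4 → ℤ), hessKer (AN j) (𝒱N j) (𝒲N j) μ ν z = 𝒯 (j + 1) μ ν z)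
    (hF : ∀ j : ℕ, 1 ≤ j → ∀ (μ ν : Fin 4) (z : Fin 4 → ℤ),
      hessKer (AF j) (𝒱F j) (𝒲F j) μ ν z = (Lc : ℝ) ^ 8 * dressedEntry (w j) (𝒯 j) ((Lc : ℤ) • z) μ ν)
    (hG : ∀ j : ℕ, 1 ≤ j → ∀ (μ ν : Fin 4) (z : Fin 4 → ℤ), hessKer (AG j) (𝒱G j) (𝒲G j) μ ν z = T j μ ν z) :
    StepRecursion Lc T 𝒯 w :=
  stepRecursion_of_kernel_laws (fun j => hessKer (AN j) (𝒱N j) (𝒲N j)) (fun j => hessKer (AF j) (𝒱F j) (𝒲F j))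
    (fun j => hessKer (AG j) (𝒱G j) (𝒲G j)) hlaw hN hF hG

end HessKer

/-! ## §5 At the (III′) literal of record: `hbase` discharged by an2's `TshotOf_JcOf_one` -/

section Literal

variable {Lc : ℕ} [NeZero Lc]

/-- [folklore] **`D1Tel` AT THE (III′) LITERAL OF RECORD FROM THE ROAD's KERNEL ROWS** — M‴'s `htel` binder (`CombRemainderParityAll` :272,
`htel : D1Tel Lc (JsB12CombShSym hLc N (symTablesAn1S2 3 Lc cΛ) cΛ cB) Jc`) at `Jc := JcOf hLc N (fun _ => cΛ) (fun _ => cB)` (an2's (J1) naming): (L1) the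
de-periodised door per `j ≥ 1`, (L2′) the three identifications at the canonical weight `wStep Lc`, (L4′) (T0)(T1) of the step kernels ⟹ `D1Tel`; (L3′) `hbase` is
an2's `CombOneShotJets.TshotOf_JcOf_one` — DISCHARGED here, not displayed. -/
theorem d1Tel_JcOf_of_kernel_laws_wStep (hLc : Odd Lc) (N : ℕ) (cΛ cB : ℝ) (𝒦N 𝒦F 𝒦G : ℕ → EKer 4)
    (hlaw : ∀ j : ℕ, 1 ≤ j → ∀ (a b : Fin 4) (z : Fin 4 → ℤ), 𝒦N j a b z = 𝒦F j a b z + 𝒦G j a b z)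
    (hN : ∀ j : ℕ, 1 ≤ j → ∀ (a b : Fin 4) (z : Fin 4 → ℤ),
      𝒦N j a b z = TshotOf Lc (JcOf hLc N (fun _ => cΛ) (fun _ => cB)) (j + 1) a b z)
    (hF : ∀ j : ℕ, 1 ≤ j → ∀ (a b : Fin 4) (z : Fin 4 → ℤ),
      𝒦F j a b z = (Lc : ℝ) ^ 8 * dressedEntry (wStep Lc j) (TshotOf Lc (JcOf hLc N (fun _ => cΛ) (fun _ => cB)) j) ((Lc : ℤ) • z) a b)
    (hG : ∀ j : ℕ, 1 ≤ j → ∀ (a b : Fin 4) (z : Fin 4 → ℤ),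
      𝒦G j a b z = TbalOf Lc (JsB12CombShSym hLc N (symTablesAn1S2 3 Lc cΛ) cΛ cB) j a b z)
    (hT0 : ∀ j (c e : Fin 4), HasSum (TbalOf Lc (JsB12CombShSym hLc N (symTablesAn1S2 3 Lc cΛ) cΛ cB) j c e) 0)
    (hT1 : ∀ j (c e ρ : Fin 4), HasSum (fun t : Fin 4 → ℤ => t ρ • TbalOf Lc (JsB12CombShSym hLc N (symTablesAn1S2 3 Lc cΛ) cΛ cB) j c e t) 0) :
    D1Tel Lc (JsB12CombShSym hLc N (symTablesAn1S2 3 Lc cΛ) cΛ cB) (JcOf hLc N (fun _ => cΛ) (fun _ => cB)) :=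
  d1Tel_of_kernel_laws_wStep _ _ 𝒦N 𝒦F 𝒦G hlaw hN hF hG hT0 hT1 (TshotOf_JcOf_one hLc N (fun _ => cΛ) (fun _ => cB))

/-- [folklore] **THE SAME ON THE PRICED BRANCH (R-FP-56 (b))**: the door with a defect family `D j` whose decimated moments of order 0∕1 vanish, with `AbsMoment₂`
and vanishing second-moment tensor, at the literal of record ⟹ M‴'s `htel` at `Jc := JcOf …`; `hbase` discharged. -/
theorem d1Tel_JcOf_of_kernel_laws_upTo_wStep (hLc : Odd Lc) (N : ℕ) (cΛ cB : ℝ) (𝒦N 𝒦F 𝒦G D : ℕ → EKer 4)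
    (hlaw : ∀ j : ℕ, 1 ≤ j → ∀ (a b : Fin 4) (z : Fin 4 → ℤ), 𝒦N j a b z = 𝒦F j a b z + 𝒦G j a b z + D j a b z)
    (hN : ∀ j : ℕ, 1 ≤ j → ∀ (a b : Fin 4) (z : Fin 4 → ℤ),
      𝒦N j a b z = TshotOf Lc (JcOf hLc N (fun _ => cΛ) (fun _ => cB)) (j + 1) a b z)
    (hF : ∀ j : ℕ, 1 ≤ j → ∀ (a b : Fin 4) (z : Fin 4 → ℤ),
      𝒦F j a b z = (Lc : ℝ) ^ 8 * dressedEntry (wStep Lc j) (TshotOf Lc (JcOf hLc N (fun _ => cΛ) (fun _ => cB)) j) ((Lc : ℤ) • z) a b)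
    (hG : ∀ j : ℕ, 1 ≤ j → ∀ (a b : Fin 4) (z : Fin 4 → ℤ),
      𝒦G j a b z = TbalOf Lc (JsB12CombShSym hLc N (symTablesAn1S2 3 Lc cΛ) cΛ cB) j a b z)
    (hT0 : ∀ j (c e : Fin 4), HasSum (TbalOf Lc (JsB12CombShSym hLc N (symTablesAn1S2 3 Lc cΛ) cΛ cB) j c e) 0)
    (hT1 : ∀ j (c e ρ : Fin 4), HasSum (fun t : Fin 4 → ℤ => t ρ • TbalOf Lc (JsB12CombShSym hLc N (symTablesAn1S2 3 Lc cΛ) cΛ cB) j c e t) 0)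
    (hD0 : ∀ j, 1 ≤ j → ∀ c e : Fin 4, HasSum (D j c e) 0)
    (hD1 : ∀ j, 1 ≤ j → ∀ c e ρ : Fin 4, HasSum (fun t : Fin 4 → ℤ => t ρ • D j c e t) 0)
    (hDA : ∀ j, 1 ≤ j → ∀ c e : Fin 4, AbsMoment₂ (D j c e)) (hD2 : ∀ j, 1 ≤ j → m2Tensor (D j) = 0) :
    D1Tel Lc (JsB12CombShSym hLc N (symTablesAn1S2 3 Lc cΛ) cΛ cB) (JcOf hLc N (fun _ => cΛ) (fun _ => cB)) :=
  d1Tel_of_kernel_laws_upTo_wStep _ _ 𝒦N 𝒦F 𝒦G D hlaw hN hF hG hT0 hT1 hD0 hD1 hDA hD2 (TshotOf_JcOf_one hLc N (fun _ => cΛ) (fun _ => cB))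

/-- [folklore] **`D1Tel` AT M‴'s LITERAL FOR ANY COMPOSITE FAMILY ANCHORED AT `m = 1`** (R-D1-g42-4 (3): «`Jc` of record = the composite-contour
literal `JcComp = JcOfTabs tabsComp`; `JcOf` stays the `m = 1` anchor»): for ANY `Jc : ∀ m, JetData 3 (Lc^m)` whose depth-1 member IS `JcOf`'s
(`hJc1` — composite of one step = the step), the road's rows (L1)(L2′) at that `Jc` + (L4′) ⟹ `D1Tel Lc (JsB12CombShSym …) Jc`; `hbase` discharged through
the anchor (`TshotOf Lc Jc 1` reads only `Jc 1`) and an2's `TshotOf_JcOf_one`.  So the (F1) END is typed for `JcComp` BEFORE it is named. -/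
theorem d1Tel_anchored_of_kernel_laws_wStep (hLc : Odd Lc) (N : ℕ) (cΛ cB : ℝ) (Jc : ∀ m : ℕ, JetData 3 (Lc ^ m))
    (hJc1 : Jc 1 = JcOf hLc N (fun _ => cΛ) (fun _ => cB) 1) (𝒦N 𝒦F 𝒦G : ℕ → EKer 4)
    (hlaw : ∀ j : ℕ, 1 ≤ j → ∀ (a b : Fin 4) (z : Fin 4 → ℤ), 𝒦N j a b z = 𝒦F j a b z + 𝒦G j a b z)
    (hN : ∀ j : ℕ, 1 ≤ j → ∀ (a b : Fin 4) (z : Fin 4 → ℤ), 𝒦N j a b z = TshotOf Lc Jc (j + 1) a b z)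
    (hF : ∀ j : ℕ, 1 ≤ j → ∀ (a b : Fin 4) (z : Fin 4 → ℤ),
      𝒦F j a b z = (Lc : ℝ) ^ 8 * dressedEntry (wStep Lc j) (TshotOf Lc Jc j) ((Lc : ℤ) • z) a b)
    (hG : ∀ j : ℕ, 1 ≤ j → ∀ (a b : Fin 4) (z : Fin 4 → ℤ),
      𝒦G j a b z = TbalOf Lc (JsB12CombShSym hLc N (symTablesAn1S2 3 Lc cΛ) cΛ cB) j a b z)
    (hT0 : ∀ j (c e : Fin 4), HasSum (TbalOf Lc (JsB12CombShSym hLc N (symTablesAn1S2 3 Lc cΛ) cΛ cB) j c e) 0)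
    (hT1 : ∀ j (c e ρ : Fin 4), HasSum (fun t : Fin 4 → ℤ => t ρ • TbalOf Lc (JsB12CombShSym hLc N (symTablesAn1S2 3 Lc cΛ) cΛ cB) j c e t) 0) :
    D1Tel Lc (JsB12CombShSym hLc N (symTablesAn1S2 3 Lc cΛ) cΛ cB) Jc := by
  have hbase : TshotOf Lc Jc 1 = TbalOf Lc (JsB12CombShSym hLc N (symTablesAn1S2 3 Lc cΛ) cΛ cB) 0 := by
    have h1 : TshotOf Lc Jc 1 = TshotOf Lc (JcOf hLc N (fun _ => cΛ) (fun _ => cB)) 1 := by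
      show OneStepResolventKernel.TOf (N := Lc ^ 1) (Jc 1) = OneStepResolventKernel.TOf (N := Lc ^ 1) (JcOf hLc N (fun _ => cΛ) (fun _ => cB) 1)
      rw [hJc1]
    exact h1.trans (TshotOf_JcOf_one hLc N (fun _ => cΛ) (fun _ => cB))
  exact d1Tel_of_kernel_laws_wStep _ _ 𝒦N 𝒦F 𝒦G hlaw hN hF hG hT0 hT1 hbase

end Literal

end Summit.QuantumFields.BalabanUV.Beta.FP.StepRecursionFeed

end
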